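import Mathlib.NumberTheory.Harmonic.EulerMascheroni
import Literature.NumberTheory.LFunctions.DirichletLOneDerivTail
import Literature.NumberTheory.Sieve.CoprimeSquarefreeSums
import HarnessLib

/-!
# `∑_{n ≤ N} (1 ∗ χ)(n)/n = (log N + γ) L(1, χ) + L'(1, χ) + O(B log N/Y + Y/N)` by the
# hyperbola method (Montgomery–Vaughan §11.2, Exercise 3(c)–(g))

Topic `Literature/NumberTheory/LFunctions`. Everything in this file is PROVED (theorems only).

Let `χ ≠ χ₀` be a Dirichlet character mod `q` whose partial sums are bounded by `B`, and let
`r(n) = ∑_{d ∣ n} χ(d)`. For integers `2 ≤ Y ≤ N` we prove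
`|∑_{n=1}^{N} r(n)/n − ((log N + γ) L(1, χ) + L'(1, χ))| ≤ 8B(log N + 1)/(Y + 1) + 4Y/N`
(`norm_sum_divisorSum_div_sub_le`): the hyperbola method — `∑_{n ≤ N} r(n)/n =
∑_{d ≤ N} (χ(d)/d) H(⌊N/d⌋)`, `H(k) = ∑_{m ≤ k} 1/m = log k + γ + O(1/k)` (Mathlib's
`Real.eulerMascheroniSeq`/`eulerMascheroniSeq'` envelope of `γ`), the ranges `d ≤ Y` (giving
`(log N + γ)∑_{d ≤ Y} χ(d)/d − ∑_{d ≤ Y} χ(d) log d/d`, evaluated by Exercise 3(a),(b):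
`DirichletLOneTail.lean`, `DirichletLOneDerivTail.lean`) and `d > Y` (swapped:
`∑_{e} (1/e) ∑_{Y < d ≤ N/e} χ(d)/d = O(B log N/Y)`). With the Pólya–Vinogradov `B = √q(1 + log q)`
this is Montgomery–Vaughan's Exercise 11.2.3(g) "`∑_{n ≤ x} r(n)/n = (log x + C₀)L(1, χ) +
L'(1, χ) + O(q^{1/4} x^{−1/2} (log qx)^{3/2})`" (on choosing `Y ≍ (Bx)^{1/2}`; we keep `Y` free),
the input "(11.??) of [MV]" of Tao–Teräväinen's Proposition 3.5 and Matomäki–Merikoski's Lemma 4.1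
for exceptional characters.

## References

* H. L. Montgomery, R. C. Vaughan, *Multiplicative Number Theory I*, CUP 2007, §11.2.1
  Exercise 3 (pp. 285–286), parts (c)–(g). [cite: MontgomeryVaughan2007, §11.2.1 Exercise 3(g)]
* K. Matomäki, J. Merikoski, *Siegel zeros, twin primes …*, IMRN 2023, proof of Lemma 4.1
  ("By [MVBook] we have for any `y ≥ q^{1/2+δ}`,
  `∑_{m ≤ y} λ(m)/m = L(1,χ)(log y + γ) + L'(1,χ) + O_δ(q^{−δ/3})`").
  [cite: MatomakiMerikoski2023, §4]
-/

noncomputable section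

open Complex Filter Topology Finset

namespace Literature.NumberTheory.LFunctions.DirichletAbel

variable {q : ℕ} [NeZero q] (χ : DirichletCharacter ℂ q)

/-! ### Interval bookkeeping -/

omit [NeZero q] in
/-- `∑_{d ∈ [1, M]} g(d) = ∑_{n < M} g(n + 1)`. [folklore] -/
theorem sum_Icc_one_eq_sum_range {M' : Type*} [AddCommMonoid M'] (g : ℕ → M') (M : ℕ) :
    ∑ d ∈ Icc 1 M, g d = ∑ n ∈ range M, g (n + 1) := by
  rw [← Finset.Ico_add_one_right_eq_Icc, Finset.sum_Ico_eq_sum_range,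
    show M + 1 - 1 = M by omega]
  refine sum_congr rfl fun n _ => ?_
  rw [add_comm]

/-- Exercise 3(a) in interval form: `‖∑_{d=1}^{M} χ(d)/d − L(1, χ)‖ ≤ 2B/(M+1)`.
[cite: MontgomeryVaughan2007, §11.2.1 Exercise 3(a)] -/
theorem norm_sum_Icc_div_sub_LFunction_one_le (hχ : χ ≠ 1) {B : ℝ}
    (hB : ∀ n, ‖partialSum χ n‖ ≤ B) (M : ℕ) :
    ‖(∑ d ∈ Icc 1 M, χ (d : ZMod q) / (d : ℂ)) - χ.LFunction 1‖ ≤ 2 * B / ((M : ℝ) + 1) := by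
  have h := norm_sum_div_sub_LFunction_one_le χ hχ hB M
  rw [sum_Icc_one_eq_sum_range]
  convert h using 4 with n
  push_cast; ring_nf

/-- Exercise 3(b) in interval form: `‖∑_{d=1}^{M} χ(d) log d/d + L'(1, χ)‖ ≤ 2B log(M+1)/(M+1)`
for `M ≥ 2`. [cite: MontgomeryVaughan2007, §11.2.1 Exercise 3(b)] -/
theorem norm_sum_Icc_log_div_add_deriv_le (hχ : χ ≠ 1) {B : ℝ}
    (hB : ∀ n, ‖partialSum χ n‖ ≤ B) {M : ℕ} (hM : 2 ≤ M) :
    ‖(∑ d ∈ Icc 1 M, χ (d : ZMod q) * ((Real.log d / d : ℝ) : ℂ)) + deriv χ.LFunction 1‖ ≤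
      2 * B * (Real.log ((M : ℝ) + 1) / ((M : ℝ) + 1)) := by
  have h := norm_sum_log_div_add_deriv_LFunction_one_le χ hχ hB hM
  rw [sum_Icc_one_eq_sum_range]
  convert h using 5 with n
  push_cast; ring_nf

/-- The character sum over a range `(Y, M]`: `‖∑_{Y < d ≤ M} χ(d)/d‖ ≤ 4B/(Y+1)`.
[cite: MontgomeryVaughan2007, §11.2.1 Exercise 3(e)] -/
theorem norm_sum_Icc_filter_div_le (hχ : χ ≠ 1) {B : ℝ} (hB : ∀ n, ‖partialSum χ n‖ ≤ B)
    (Y M : ℕ) :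
    ‖∑ d ∈ (Icc 1 M).filter (fun d => Y < d), χ (d : ZMod q) / (d : ℂ)‖ ≤ 4 * B / ((Y : ℝ) + 1) := by
  have hB0 : 0 ≤ B := (norm_nonneg _).trans (hB 0)
  rcases le_or_gt M Y with hMY | hYM
  · -- empty range
    have : (Icc 1 M).filter (fun d => Y < d) = ∅ := by
      ext d; simp only [mem_filter, mem_Icc, Finset.notMem_empty, iff_false]; omega
    rw [this, sum_empty, norm_zero]; positivity
  · have hsplit : ∑ d ∈ (Icc 1 M).filter (fun d => Y < d), χ (d : ZMod q) / (d : ℂ) =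
        (∑ d ∈ Icc 1 M, χ (d : ZMod q) / (d : ℂ)) - ∑ d ∈ Icc 1 Y, χ (d : ZMod q) / (d : ℂ) := by
      rw [eq_sub_iff_add_eq, ← Finset.sum_filter_add_sum_filter_not (Icc 1 M) (fun d => Y < d)]
      congr 1
      refine sum_congr ?_ fun _ _ => rfl
      ext d; simp only [mem_filter, mem_Icc, not_lt]; omega
    rw [hsplit]
    have h1 := norm_sum_Icc_div_sub_LFunction_one_le χ hχ hB M
    have h2 := norm_sum_Icc_div_sub_LFunction_one_le χ hχ hB Y
    have hY1 : (0 : ℝ) < (Y : ℝ) + 1 := by positivity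
    have hMY' : ((Y : ℝ) + 1) ≤ (M : ℝ) + 1 := by exact_mod_cast (by omega : Y + 1 ≤ M + 1)
    calc ‖(∑ d ∈ Icc 1 M, χ (d : ZMod q) / (d : ℂ)) - ∑ d ∈ Icc 1 Y, χ (d : ZMod q) / (d : ℂ)‖
        = ‖((∑ d ∈ Icc 1 M, χ (d : ZMod q) / (d : ℂ)) - χ.LFunction 1) -
            ((∑ d ∈ Icc 1 Y, χ (d : ZMod q) / (d : ℂ)) - χ.LFunction 1)‖ := by ring_nf
      _ ≤ 2 * B / ((M : ℝ) + 1) + 2 * B / ((Y : ℝ) + 1) := (norm_sub_le _ _).trans (add_le_add h1 h2)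
      _ ≤ 2 * B / ((Y : ℝ) + 1) + 2 * B / ((Y : ℝ) + 1) := by
          gcongr
      _ = 4 * B / ((Y : ℝ) + 1) := by ring

/-! ### The harmonic numbers against `log + γ` -/

/-- `|H(k) − (log k + γ)| ≤ 1/k` for `k ≥ 1`, from Mathlib's monotone envelopes
`H(k) − log(k+1) < γ < H(k) − log k`. [folklore] -/
theorem abs_harmonic_sub_log_sub_eulerMascheroni_le {k : ℕ} (hk : 1 ≤ k) :
    |(harmonic k : ℝ) - (Real.log k + Real.eulerMascheroniConstant)| ≤ 1 / (k : ℝ) := by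
  have hk0 : (0 : ℝ) < k := by exact_mod_cast hk
  have h1 := Real.eulerMascheroniConstant_lt_eulerMascheroniSeq' k
  rw [Real.eulerMascheroniSeq', if_neg (by omega)] at h1
  have h2 := Real.eulerMascheroniSeq_lt_eulerMascheroniConstant k
  rw [Real.eulerMascheroniSeq] at h2
  have hlog : Real.log ((k : ℝ) + 1) - Real.log k ≤ 1 / (k : ℝ) := by
    rw [← Real.log_div (by positivity) hk0.ne']
    have := Real.log_le_sub_one_of_pos (x := ((k : ℝ) + 1) / k) (by positivity)
    rw [div_sub_one hk0.ne', add_sub_cancel_left] at this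
    exact this
  rw [abs_le]
  constructor <;> linarith

/-- The harmonic number at `⌊N/d⌋` against `log N − log d + γ`: for `1 ≤ d ≤ N`,
`|H(⌊N/d⌋) − (log N − log d + γ)| ≤ 4d/N` (`1/⌊N/d⌋ < 2d/N` and
`0 ≤ log(N/d) − log⌊N/d⌋ < 1/⌊N/d⌋`). [folklore] -/
theorem abs_harmonic_div_sub_le {d N : ℕ} (hd : 1 ≤ d) (hdN : d ≤ N) :
    |(harmonic (N / d) : ℝ) - (Real.log N - Real.log d + Real.eulerMascheroniConstant)| ≤
      4 * (d : ℝ) / N := by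
  set k := N / d with hk
  have hk1 : 1 ≤ k := (Nat.le_div_iff_mul_le hd).mpr (by simpa using hdN)
  have hk0 : (0 : ℝ) < k := by exact_mod_cast hk1
  have hd0 : (0 : ℝ) < d := by exact_mod_cast hd
  have hN0 : (0 : ℝ) < N := by exact_mod_cast (hd.trans hdN)
  have hkle : (k : ℝ) * d ≤ N := by exact_mod_cast Nat.div_mul_le_self N d
  have hklt : (N : ℝ) < (k : ℝ) * d + d := by
    have h := Nat.lt_div_mul_add (a := N) hd
    rw [← hk] at h
    exact_mod_cast h
  -- `1/k < 2d/N`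
  have hN2 : (N : ℝ) < 2 * (k * d) := by
    have : (d : ℝ) ≤ k * d := le_mul_of_one_le_left hd0.le (by exact_mod_cast hk1)
    linarith
  have hinv : 1 / (k : ℝ) ≤ 2 * d / N := by
    rw [div_le_div_iff₀ hk0 hN0]
    linarith
  -- `log k ≤ log (N/d) ≤ log k + 1/k`
  have hlog1 : Real.log k ≤ Real.log N - Real.log d := by
    rw [← Real.log_div hN0.ne' hd0.ne']
    exact Real.log_le_log hk0 (by rw [le_div_iff₀ hd0]; exact hkle)
  have hlog2 : Real.log N - Real.log d ≤ Real.log k + 1 / k := by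
    rw [← Real.log_div hN0.ne' hd0.ne']
    have h1 : Real.log ((N : ℝ) / d) ≤ Real.log ((k : ℝ) + 1) :=
      Real.log_le_log (by positivity) (by rw [div_le_iff₀ hd0]; linarith)
    have h2 : Real.log ((k : ℝ) + 1) - Real.log k ≤ 1 / (k : ℝ) := by
      rw [← Real.log_div (by positivity) hk0.ne']
      have := Real.log_le_sub_one_of_pos (x := ((k : ℝ) + 1) / k) (by positivity)
      rw [div_sub_one hk0.ne', add_sub_cancel_left] at this
      exact this
    linarith
  have hH := abs_harmonic_sub_log_sub_eulerMascheroni_le hk1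
  rw [abs_le] at hH ⊢
  have h4 : 4 * (d : ℝ) / N = 2 * (2 * d / N) := by ring
  constructor <;> nlinarith [hH.1, hH.2]

/-! ### The hyperbola identity -/

omit [NeZero q] in
/-- `∑_{m=1}^{k} 1/m = H(k)` in `ℂ`. [folklore] -/
theorem sum_Icc_inv_eq_harmonic (k : ℕ) :
    ∑ e ∈ Icc 1 k, (1 : ℂ) / (e : ℂ) = ((harmonic k : ℝ) : ℂ) := by
  have h : (harmonic k : ℝ) = ∑ e ∈ Icc 1 k, (e : ℝ)⁻¹ := by
    rw [harmonic_eq_sum_Icc]; push_cast; rfl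
  rw [h]; push_cast
  refine sum_congr rfl fun e _ => ?_
  rw [one_div]

omit [NeZero q] in
/-- **The hyperbola identity** `∑_{n ≤ N} r(n)/n = ∑_{d ≤ N} (χ(d)/d) H(⌊N/d⌋)`, `r = 1 ∗ χ`
(MV Exercise 11.2.3(c)). [cite: MontgomeryVaughan2007, §11.2.1 Exercise 3(c)] -/
theorem sum_divisorSum_div_eq (N : ℕ) :
    ∑ n ∈ Icc 1 N, (∑ d ∈ n.divisors, χ (d : ZMod q)) / (n : ℂ) =
      ∑ d ∈ Icc 1 N, χ (d : ZMod q) / (d : ℂ) * ((harmonic (N / d) : ℝ) : ℂ) := by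
  have hstep : ∀ n ∈ Icc 1 N, (∑ d ∈ n.divisors, χ (d : ZMod q)) / (n : ℂ) =
      ∑ i ∈ n.divisorsAntidiagonal, χ (i.1 : ZMod q) / (i.1 : ℂ) / (i.2 : ℂ) := by
    intro n hn
    rw [Nat.sum_divisorsAntidiagonal (f := fun d e => χ (d : ZMod q) / (d : ℂ) / (e : ℂ)),
      Finset.sum_div]
    refine sum_congr rfl fun d hd => ?_
    have hdn : d ∣ n := Nat.dvd_of_mem_divisors hd
    have hd0 : (d : ℂ) ≠ 0 := by exact_mod_cast (Nat.pos_of_mem_divisors hd).ne'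
    rw [div_div, ← Nat.cast_mul, Nat.mul_div_cancel' hdn]
  rw [sum_congr rfl hstep,
    Literature.NumberTheory.Sieve.SquarefreeSums.sum_Icc_sum_divisorsAntidiagonal
      (fun d e => χ (d : ZMod q) / (d : ℂ) / (e : ℂ)) N]
  refine sum_congr rfl fun d _ => ?_
  rw [← sum_Icc_inv_eq_harmonic, Finset.mul_sum]
  refine sum_congr rfl fun e _ => ?_
  ring

omit [NeZero q] in
/-- Swapping the two variables of an antidiagonal double sum. [folklore] -/
theorem sum_divisorsAntidiagonal_swap {M' : Type*} [AddCommMonoid M'] (G : ℕ → ℕ → M') (n : ℕ) :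
    ∑ i ∈ n.divisorsAntidiagonal, G i.1 i.2 = ∑ i ∈ n.divisorsAntidiagonal, G i.2 i.1 := by
  conv_lhs => rw [← Nat.map_swap_divisorsAntidiagonal, Finset.sum_map]
  rfl

omit [NeZero q] in
/-- **The tail of the hyperbola sum, swapped**: `∑_{Y < d ≤ N} (χ(d)/d) H(⌊N/d⌋)
= ∑_{e ≤ N} (1/e) ∑_{Y < d ≤ N/e} χ(d)/d` (both equal `∑_{de ≤ N, d > Y} χ(d)/(de)`;
MV Exercise 11.2.3(c), the term `Σ₂ − Σ₃`). [cite: MontgomeryVaughan2007, §11.2.1 Exercise 3(c)] -/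
theorem sum_filter_mul_harmonic_eq_swap (N Y : ℕ) :
    ∑ d ∈ (Icc 1 N).filter (fun d => Y < d), χ (d : ZMod q) / (d : ℂ) * ((harmonic (N / d) : ℝ) : ℂ) =
      ∑ e ∈ Icc 1 N, (1 : ℂ) / (e : ℂ) *
        ∑ d ∈ (Icc 1 (N / e)).filter (fun d => Y < d), χ (d : ZMod q) / (d : ℂ) := by
  set F : ℕ → ℕ → ℂ := fun d e => if Y < d then χ (d : ZMod q) / (d : ℂ) / (e : ℂ) else 0 with hF
  have hL := Literature.NumberTheory.Sieve.SquarefreeSums.sum_Icc_sum_divisorsAntidiagonal F N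
  have hR := Literature.NumberTheory.Sieve.SquarefreeSums.sum_Icc_sum_divisorsAntidiagonal
    (fun e d => F d e) N
  have hswap : ∑ n ∈ Icc 1 N, ∑ i ∈ n.divisorsAntidiagonal, F i.1 i.2 =
      ∑ n ∈ Icc 1 N, ∑ i ∈ n.divisorsAntidiagonal, (fun e d => F d e) i.1 i.2 :=
    sum_congr rfl fun n _ => sum_divisorsAntidiagonal_swap F n
  -- left side
  have hL' : ∑ d ∈ Icc 1 N, ∑ e ∈ Icc 1 (N / d), F d e =
      ∑ d ∈ (Icc 1 N).filter (fun d => Y < d),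
        χ (d : ZMod q) / (d : ℂ) * ((harmonic (N / d) : ℝ) : ℂ) := by
    rw [Finset.sum_filter]
    refine sum_congr rfl fun d _ => ?_
    split_ifs with hYd
    · rw [← sum_Icc_inv_eq_harmonic, Finset.mul_sum]
      refine sum_congr rfl fun e _ => ?_
      rw [hF]; simp only [if_pos hYd]; ring
    · refine sum_eq_zero fun e _ => ?_
      rw [hF]; simp only [if_neg hYd]
  -- right side
  have hR' : ∑ e ∈ Icc 1 N, ∑ d ∈ Icc 1 (N / e), F d e =
      ∑ e ∈ Icc 1 N, (1 : ℂ) / (e : ℂ) *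
        ∑ d ∈ (Icc 1 (N / e)).filter (fun d => Y < d), χ (d : ZMod q) / (d : ℂ) := by
    refine sum_congr rfl fun e _ => ?_
    rw [Finset.sum_filter, Finset.mul_sum]
    refine sum_congr rfl fun d _ => ?_
    rw [hF]
    simp only
    split_ifs <;> ring
  rw [← hL', ← hL, hswap, hR, hR']

/-! ### The estimates -/

/-- The swapped tail is `≤ 4B(1 + log N)/(Y + 1)` in norm (MV Exercise 11.2.3(e),(f)).
[cite: MontgomeryVaughan2007, §11.2.1 Exercise 3(e)] -/
theorem norm_tail_le (hχ : χ ≠ 1) {B : ℝ} (hB : ∀ n, ‖partialSum χ n‖ ≤ B) (N Y : ℕ) :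
    ‖∑ e ∈ Icc 1 N, (1 : ℂ) / (e : ℂ) *
        ∑ d ∈ (Icc 1 (N / e)).filter (fun d => Y < d), χ (d : ZMod q) / (d : ℂ)‖ ≤
      4 * B * (1 + Real.log N) / ((Y : ℝ) + 1) := by
  have hB0 : 0 ≤ B := (norm_nonneg _).trans (hB 0)
  have hterm : ∀ e ∈ Icc 1 N, ‖(1 : ℂ) / (e : ℂ) *
      ∑ d ∈ (Icc 1 (N / e)).filter (fun d => Y < d), χ (d : ZMod q) / (d : ℂ)‖ ≤
      (e : ℝ)⁻¹ * (4 * B / ((Y : ℝ) + 1)) := by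
    intro e he
    rw [mem_Icc] at he
    rw [norm_mul, norm_div, norm_one, Complex.norm_natCast, one_div]
    exact mul_le_mul_of_nonneg_left (norm_sum_Icc_filter_div_le χ hχ hB Y (N / e)) (by positivity)
  refine (norm_sum_le _ _).trans ((sum_le_sum hterm).trans ?_)
  rw [← Finset.sum_mul]
  have hharm : ∑ e ∈ Icc 1 N, (e : ℝ)⁻¹ = (harmonic N : ℝ) := by
    rw [harmonic_eq_sum_Icc]; push_cast; rfl
  rw [hharm]
  have hH : (harmonic N : ℝ) ≤ 1 + Real.log N := harmonic_le_one_add_log N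
  have hY : (0 : ℝ) < (Y : ℝ) + 1 := by positivity
  calc (harmonic N : ℝ) * (4 * B / ((Y : ℝ) + 1)) ≤ (1 + Real.log N) * (4 * B / ((Y : ℝ) + 1)) := by
        gcongr
    _ = 4 * B * (1 + Real.log N) / ((Y : ℝ) + 1) := by ring

omit [NeZero q] in
/-- The head `∑_{d ≤ Y} (χ(d)/d) H(⌊N/d⌋)` against `(log N + γ)∑_{d ≤ Y} χ(d)/d − ∑_{d ≤ Y} χ(d) log d/d`:
the difference is at most `4Y/N` (MV Exercise 11.2.3(d)). [cite: MontgomeryVaughan2007, §11.2.1 Exercise 3(d)] -/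
theorem norm_head_sub_le {N Y : ℕ} (hYN : Y ≤ N) :
    ‖(∑ d ∈ Icc 1 Y, χ (d : ZMod q) / (d : ℂ) * ((harmonic (N / d) : ℝ) : ℂ)) -
        ((Real.log N + Real.eulerMascheroniConstant : ℝ) * ∑ d ∈ Icc 1 Y, χ (d : ZMod q) / (d : ℂ) -
          ∑ d ∈ Icc 1 Y, χ (d : ZMod q) * ((Real.log d / d : ℝ) : ℂ))‖ ≤ 4 * (Y : ℝ) / N := by
  rw [Finset.mul_sum, ← Finset.sum_sub_distrib, ← Finset.sum_sub_distrib]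
  have hterm : ∀ d ∈ Icc 1 Y, ‖χ (d : ZMod q) / (d : ℂ) * ((harmonic (N / d) : ℝ) : ℂ) -
      ((Real.log N + Real.eulerMascheroniConstant : ℝ) * (χ (d : ZMod q) / (d : ℂ)) -
        χ (d : ZMod q) * ((Real.log d / d : ℝ) : ℂ))‖ ≤ 4 / (N : ℝ) := by
    intro d hd
    rw [mem_Icc] at hd
    have hd0 : (d : ℂ) ≠ 0 := by exact_mod_cast (by omega : d ≠ 0)
    have hdpos : (0 : ℝ) < d := by exact_mod_cast hd.1
    have e : χ (d : ZMod q) / (d : ℂ) * ((harmonic (N / d) : ℝ) : ℂ) -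
        ((Real.log N + Real.eulerMascheroniConstant : ℝ) * (χ (d : ZMod q) / (d : ℂ)) -
          χ (d : ZMod q) * ((Real.log d / d : ℝ) : ℂ)) =
        χ (d : ZMod q) / (d : ℂ) *
          (((harmonic (N / d) : ℝ) - (Real.log N - Real.log d + Real.eulerMascheroniConstant) : ℝ) : ℂ) := by
      push_cast
      field_simp
      ring
    rw [e, norm_mul, norm_div, Complex.norm_natCast, Complex.norm_real, Real.norm_eq_abs]
    have h1 : ‖χ (d : ZMod q)‖ ≤ 1 := χ.norm_le_one _
    have h2 := abs_harmonic_div_sub_le hd.1 (hd.2.trans hYN)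
    calc ‖χ (d : ZMod q)‖ / (d : ℝ) *
          |(harmonic (N / d) : ℝ) - (Real.log N - Real.log d + Real.eulerMascheroniConstant)|
        ≤ 1 / (d : ℝ) * (4 * (d : ℝ) / N) := by
          apply mul_le_mul _ h2 (abs_nonneg _) (by positivity)
          exact div_le_div_of_nonneg_right h1 hdpos.le
      _ = 4 / (N : ℝ) := by field_simp
  refine (norm_sum_le _ _).trans ((sum_le_sum hterm).trans ?_)
  rw [sum_const, Nat.card_Icc, show Y + 1 - 1 = Y by omega, nsmul_eq_mul]
  ring_nf
  rfl

/-- **Montgomery–Vaughan, Exercise 11.2.3 (c)–(g), with a general partial-sum bound.** Let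
`χ ≠ χ₀` be a character mod `q` with `|∑_{m ≤ n} χ(m)| ≤ B` for all `n`, and `r(n) = ∑_{d ∣ n} χ(d)`.
For integers `2 ≤ Y ≤ N`,
`|∑_{n=1}^{N} r(n)/n − ((log N + γ) L(1, χ) + L'(1, χ))| ≤ 8B(log N + 1)/(Y + 1) + 4Y/N`.
[cite: MontgomeryVaughan2007, §11.2.1 Exercise 3(g)] -/
theorem norm_sum_divisorSum_div_sub_le (hχ : χ ≠ 1) {B : ℝ} (hB : ∀ n, ‖partialSum χ n‖ ≤ B)
    {N Y : ℕ} (hY : 2 ≤ Y) (hYN : Y ≤ N) :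
    ‖(∑ n ∈ Icc 1 N, (∑ d ∈ n.divisors, χ (d : ZMod q)) / (n : ℂ)) -
        (((Real.log N + Real.eulerMascheroniConstant : ℝ) : ℂ) * χ.LFunction 1 +
          deriv χ.LFunction 1)‖ ≤
      8 * B * (Real.log N + 1) / ((Y : ℝ) + 1) + 4 * (Y : ℝ) / N := by
  have hB0 : 0 ≤ B := (norm_nonneg _).trans (hB 0)
  have hN1 : 1 ≤ N := le_trans (by omega) hYN
  have hN0 : (0 : ℝ) < N := by exact_mod_cast hN1
  have hlogN : 0 ≤ Real.log N := Real.log_nonneg (by exact_mod_cast hN1)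
  have hγ0 : 0 ≤ Real.eulerMascheroniConstant :=
    (by norm_num : (0 : ℝ) ≤ 1 / 2).trans Real.one_half_lt_eulerMascheroniConstant.le
  have hγ1 : Real.eulerMascheroniConstant ≤ 1 :=
    Real.eulerMascheroniConstant_lt_two_thirds.le.trans (by norm_num)
  have hY0 : (0 : ℝ) < (Y : ℝ) + 1 := by positivity
  -- notation
  set a : ℕ → ℂ := fun d => χ (d : ZMod q) / (d : ℂ) with ha
  set Hh : ℕ → ℂ := fun k => ((harmonic k : ℝ) : ℂ) with hHh
  set L : ℂ := χ.LFunction 1 with hLdef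
  set L' : ℂ := deriv χ.LFunction 1 with hL'def
  set c : ℝ := Real.log N + Real.eulerMascheroniConstant with hc
  have hc0 : 0 ≤ c := add_nonneg hlogN hγ0
  set AY : ℂ := ∑ d ∈ Icc 1 Y, a d with hAY
  set LY : ℂ := ∑ d ∈ Icc 1 Y, χ (d : ZMod q) * ((Real.log d / d : ℝ) : ℂ) with hLY
  set head : ℂ := ∑ d ∈ Icc 1 Y, a d * Hh (N / d) with hhead
  set tail : ℂ := ∑ d ∈ (Icc 1 N).filter (fun d => Y < d), a d * Hh (N / d) with htail
  -- the hyperbola identity and the split at `Y`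
  have hT : ∑ n ∈ Icc 1 N, (∑ d ∈ n.divisors, χ (d : ZMod q)) / (n : ℂ) = head + tail := by
    rw [sum_divisorSum_div_eq, hhead, htail,
      ← Finset.sum_filter_add_sum_filter_not (Icc 1 N) (fun d => d ≤ Y)]
    congr 1
    · refine sum_congr ?_ fun _ _ => rfl
      ext d; simp only [mem_filter, mem_Icc]; omega
    · refine sum_congr ?_ fun _ _ => rfl
      ext d; simp only [mem_filter, mem_Icc, not_le]
  -- the four error terms
  have e1 : ‖AY - L‖ ≤ 2 * B / ((Y : ℝ) + 1) := norm_sum_Icc_div_sub_LFunction_one_le χ hχ hB Y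
  have e2 : ‖LY + L'‖ ≤ 2 * B * (Real.log ((Y : ℝ) + 1) / ((Y : ℝ) + 1)) :=
    norm_sum_Icc_log_div_add_deriv_le χ hχ hB hY
  have e3 : ‖head - ((c : ℂ) * AY - LY)‖ ≤ 4 * (Y : ℝ) / N := norm_head_sub_le χ hYN
  have e4 : ‖tail‖ ≤ 4 * B * (1 + Real.log N) / ((Y : ℝ) + 1) := by
    rw [htail, sum_filter_mul_harmonic_eq_swap]
    exact norm_tail_le χ hχ hB N Y
  -- combine
  have hdecomp : head + tail - ((c : ℂ) * L + L') =
      (c : ℂ) * (AY - L) - (LY + L') + (head - ((c : ℂ) * AY - LY)) + tail := by ring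
  rw [hT, hdecomp]
  have hcn : ‖(c : ℂ) * (AY - L)‖ ≤ c * (2 * B / ((Y : ℝ) + 1)) := by
    rw [norm_mul, Complex.norm_real, Real.norm_eq_abs, abs_of_nonneg hc0]
    exact mul_le_mul_of_nonneg_left e1 hc0
  have hlogY : Real.log ((Y : ℝ) + 1) ≤ Real.log N + 1 := by
    have h1 : Real.log ((Y : ℝ) + 1) ≤ Real.log ((N : ℝ) + 1) :=
      Real.log_le_log hY0 (by exact_mod_cast Nat.add_le_add_right hYN 1)
    have h2 : Real.log ((N : ℝ) + 1) - Real.log N ≤ 1 := by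
      rw [← Real.log_div (by positivity) hN0.ne']
      have := Real.log_le_sub_one_of_pos (x := ((N : ℝ) + 1) / N) (by positivity)
      rw [div_sub_one hN0.ne', add_sub_cancel_left] at this
      exact this.trans (by rw [div_le_one hN0]; exact_mod_cast hN1)
    linarith
  calc ‖(c : ℂ) * (AY - L) - (LY + L') + (head - ((c : ℂ) * AY - LY)) + tail‖
      ≤ ‖(c : ℂ) * (AY - L)‖ + ‖LY + L'‖ + ‖head - ((c : ℂ) * AY - LY)‖ + ‖tail‖ := by
        refine (norm_add_le _ _).trans (add_le_add ((norm_add_le _ _).trans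
          (add_le_add ((norm_sub_le _ _).trans le_rfl) le_rfl)) le_rfl)
    _ ≤ c * (2 * B / ((Y : ℝ) + 1)) + 2 * B * (Real.log ((Y : ℝ) + 1) / ((Y : ℝ) + 1)) +
          4 * (Y : ℝ) / N + 4 * B * (1 + Real.log N) / ((Y : ℝ) + 1) :=
        add_le_add (add_le_add (add_le_add hcn e2) e3) e4
    _ ≤ (Real.log N + 1) * (2 * B / ((Y : ℝ) + 1)) + 2 * B * ((Real.log N + 1) / ((Y : ℝ) + 1)) +
          4 * (Y : ℝ) / N + 4 * B * (1 + Real.log N) / ((Y : ℝ) + 1) := by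
        gcongr
        · rw [hc]; linarith
    _ = 8 * B * (Real.log N + 1) / ((Y : ℝ) + 1) + 4 * (Y : ℝ) / N := by ring

/-- **Montgomery–Vaughan, Exercise 11.2.3(g)** for a primitive character mod `q ≥ 2`
(Pólya–Vinogradov `B = √q(1 + log q)`): for `2 ≤ Y ≤ N`,
`|∑_{n=1}^{N} r(n)/n − ((log N + γ)L(1, χ) + L'(1, χ))| ≤ 8√q(1 + log q)(log N + 1)/(Y+1) + 4Y/N`.
[cite: MontgomeryVaughan2007, §11.2.1 Exercise 3(g)] -/
theorem norm_sum_divisorSum_div_sub_le_polyaVinogradov (hq : 2 ≤ q) (hχ : χ.IsPrimitive)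
    {N Y : ℕ} (hY : 2 ≤ Y) (hYN : Y ≤ N) :
    ‖(∑ n ∈ Icc 1 N, (∑ d ∈ n.divisors, χ (d : ZMod q)) / (n : ℂ)) -
        (((Real.log N + Real.eulerMascheroniConstant : ℝ) : ℂ) * χ.LFunction 1 +
          deriv χ.LFunction 1)‖ ≤
      8 * (Real.sqrt q * (1 + Real.log q)) * (Real.log N + 1) / ((Y : ℝ) + 1) + 4 * (Y : ℝ) / N := by
  have hχ1 : χ ≠ 1 := by
    rintro rfl
    rw [DirichletCharacter.isPrimitive_def, DirichletCharacter.conductor_one] at hχ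
    omega
  exact norm_sum_divisorSum_div_sub_le χ hχ1 (norm_partialSum_le_polyaVinogradov χ hq hχ) hY hYN

end Literature.NumberTheory.LFunctions.DirichletAbel
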